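/-
Copyright: statement-level skeleton of a published paper (lit-balaban cell, Phase-2 proof seat p19, gen 3). No claims beyond
what the kernel checks below.
-/
import Mathlib
import Literature.MathematicalPhysics.QuantumFieldTheory.Balaban1983to89.B3Ineq213Amplitude
import Literature.MathematicalPhysics.QuantumFieldTheory.Balaban1983to89.B3Ineq215Assembly

/-!
# B3 — T. Bałaban, *(Higgs)₂,₃ quantum fields in a finite volume. III. Renormalization*, CMP **88** (1983) 411–445
[Balaban1983Higgs3] — Sect. 2, p. 426: **the first estimate (2.13), PROVED** for the concrete class of localized lattice
graph amplitudes of its printed derivation (MODEL INSTANCE of the typed row B3.Eq2.13-2.14), and the bound of Proposition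
2.1 for the model via (2.15)

statement-level skeleton of published theorems with citation tags; proofs where landed; nothing here is a claim about
the Yang–Mills mass gap

PDF held: `paper:balaban1983-higgs-2-3-quantum-fields-finite-volume` (journal page = PDF page + 410); displays read on
the ×2 renders `pub-balaban/b2b-balaban-ref1/pages/1983-cmp88-higgs23-III/1983-cmp88-higgs23-III-p010, p014 … p017-x2.png`
(pp. 420, 424–427).

Part of the Phase-2 proof of SKELETON row **B3.Eq2.13-2.14** (unit `lit-balaban-p19` gen 3, HOME
`run/shared/lean/pub/lit-balaban/`): files `B3Ineq213Points` → `B3Ineq213TreeLength` → `B3Ineq213Amplitude` →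
`B3Ineq213Proof`, sub-namespace `…Balaban1983to89.B3Ineq213`; the row was typed by r15 as the claim
`B3Sect2FirstEstimate.Ineq213` (p243824) with the values `E(G(j), {□(v)}, Φ′_ext, A_ext)` supplied abstractly; the weight
(2.14) and the estimate (2.15) are the gen-2 files `B3Ineq215Quotient … B3Ineq215Proof` (`Model.W`, `Model.ineq215_of_pos`),
knitted to r15's carrier in `B3Ineq215Instance` (`Counts.toScaledGraph`, `Counts.Etilde_eq_W`) and assembled with
(2.13)-as-hypothesis in `B3Ineq215Assembly` (`Counts.bound133_of_ineq213`).

WHAT IS REPRODUCED.  p. 426 [PDF 16], the end of the derivation of **(2.13)**, verbatim: *"In the obtained expression we make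
some partial summations. For a vertex v ∈ G(j) let j(v) be a lowest index of the lines with an end in this vertex. We
localize further the expression to cubes Δ(v) of the size L^{j(v)}η, i.e. we have Σ_{x(or b)∈□(v)} η^d … = Σ_{Δ(v)⊂□(v)}
(L^{j(v)}η)^d …. For each line we extract a part of the exponential factors on the right sides of (2.5), (2.10), and (2.12)
and we estimate them by exp[−½δ₁dist(□(v), □(v′))], where □(v), □(v′) are localizations of endpoints of the line. After all
these operations we get the following inequality: |Σ_{j∈J(l̃)} E(G(j), {□(v)}_{v∈G}, Φ′_ext, A_ext)| ≦
O(1)(e(L^kε))^{d_v(G)}(λ(L^kε))^{d_s(G)} exp[−(δ₁/2)d({□(v)}_{v∈G})] ‖hΦ_ext‖₁‖h′A_ext‖₁ Σ_{j∈J(l̃)} Ẽ(G(j), {□(v)}_{v∈G}),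
(2.13) where O(1) is a constant depending on n̄ only"* — PROVED for the localized lattice graph amplitudes `Amp M` of
`B3Ineq213Amplitude` (vertex functions bounded by couplings · norms · `η^{e_v}`, line kernels obeying (2.10)–(2.12),
connected graph): THEOREM `Amp.abs_E_le`: for every scale assignment `j ∈ J(l̃)` (`B3Ineq215.Model.Mon m k`), `|E_j| ≤
(Π_l C_l) · e^{d_v(G)} λ^{d_s(G)} exp[−½δ₁ d({□(v)})] (Π_v N^Φ_v)(Π_v N^A_v) · Σ_{{Δ(v)}} Ẽ(G(j), {Δ(v)})`, the last factor
being EXACTLY the gen-2 weight sum `Model.W 0 k j □` of (2.14) and `d({□(v)})` the tree length `boxTreeLen` of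
`B3Ineq213TreeLength` — i.e. (2.13) termwise with `O(1) = Π_l C_l` (the regrouping *"Σ_{x∈□(v)} η^d … = Σ_{Δ(v)⊂□(v)}
(L^{j(v)}η)^d …"* is `sum_EXP_loc` = `B3Ineq213Points.sum_pi_pts_anc`; the vertex factors `(L^{j(v)}η)^{d + e_v}` of (2.14)
absorb `η^d · (L^{j(v)})^d · η^{e_v}`, `vertexWeights_le_VF`).  COROLLARIES: `Amp.ineq213` = r15's typed row
`B3Sect2FirstEstimate.Ineq213 (Counts.toScaledGraph k j □) (Π C_l) {j} E …` BY NAME for the amplitudes over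
`Counts.toModel` (via `Counts.Etilde_eq_W`); `Amp.ineq213_sum` (the displayed sum over `j ∈ J(l̃)` on both sides); and
`Amp.bound133` = the (1.33)-shaped bound `|Σ_{j∈J(l̃)} E_j| ≤ (Π C_l)·const215·e^{d_v}λ^{d_s}exp[−½δ₁d({□(v)})](ΠN^Φ)(ΠN^A)`
for the model under the sole hypothesis of p. 426 (every connected component of every `G_i` has positive degree), by gen 2's
`Counts.bound133_of_ineq213` and (2.15) — p. 425: *"To prove the theorem it is sufficient to prove the estimate (1.33) for
the sum with fixed ordering l̃"*.  Nothing of the paper beyond this displayed mechanism is asserted; the remaining printed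
step to Proposition 2.1 (the sum over the m! orderings, (2.7)) is r15's `B3.sum_le_card_orderings_nsmul`.
-/

open Finset

namespace Literature.MathematicalPhysics.QuantumFieldTheory.Balaban1983to89.B3Ineq213

open B3Ineq215 B3Sect2FirstEstimate

/-- `Counts.toModel` keeps the block size `L`. [cite: Balaban1983Higgs3, (2.14) p.427] -/
theorem toModel_L {V : Type} [Fintype V] [DecidableEq V] {m : ℕ} (G : Counts V m) : G.toModel.L = G.L := rfl

/-- `Counts.toModel` has decay rate `δ₀ = ½δ₁`. [cite: Balaban1983Higgs3, (2.14) p.427] -/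
theorem toModel_δ₀ {V : Type} [Fintype V] [DecidableEq V] {m : ℕ} (G : Counts V m) : G.toModel.δ₀ = G.δ₁ / 2 := rfl

namespace Amp

variable {V : Type} [Fintype V] [DecidableEq V] {m : ℕ} {M : Model V m} (A : Amp M)

/-! ## The localization to the cubes `Δ(v)` and the vertex factors of (2.14) -/

/-- The admissible localizations of the gen-2 weight sum at stage `0` are the product family `Δ(v) ⊂ □(v)`,
`|Δ(v)| = (L^{j(v)}η)^d`. [cite: Balaban1983Higgs3, (2.14) p.426] -/
theorem Locs_zero_eq (j : Fin m → ℕ) :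
    M.Locs 0 A.k j A.box = Fintype.piFinset fun v => Cube.desc M.L (⟨A.k, A.box v⟩ : Cube M.d) (M.low 0 v j A.k) := by
  unfold Model.Locs
  congr 1
  funext v
  unfold Model.locF
  rw [if_pos (M.rep_zero v)]
  rfl

/-- p. 426: *"We localize further the expression to cubes Δ(v) of the size L^{j(v)}η, i.e. we have Σ_{x(or b)∈□(v)} η^d … =
Σ_{Δ(v)⊂□(v)} (L^{j(v)}η)^d …"* — the regrouping of the position sum by the localization families, for the line factors
of (2.14): each family `{Δ(v)}` collects `Π_v (L^{j(v)})^d` position tuples. [cite: Balaban1983Higgs3, (2.14) p.426] -/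
theorem sum_EXP_loc (j : Fin m → ℕ) :
    ∑ x ∈ boxPositions M.L A.k A.box, M.EXP 0 j (A.loc j x)
      = ∑ Θ ∈ M.Locs 0 A.k j A.box, (∏ v, ((M.L : ℝ) ^ M.low 0 v j A.k) ^ M.d) * M.EXP 0 j Θ := by
  rw [A.Locs_zero_eq j]
  exact sum_pi_pts_anc (L := M.L) M.L_pos (fun v => (⟨A.k, A.box v⟩ : Cube M.d)) (t := fun v => M.low 0 v j A.k)
    (fun v => M.low_le_k 0 v j A.k) (M.EXP 0 j)

/-- The vertex factors: `(Π_v η^d η^{e_v}) · Π_v (L^{j(v)})^d ≤ Π_v (L^{j(v)}η)^{d + e_v}` = the gen-2 `Model.VF 0 k j` of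
(2.14) (`η ≤ L^{j(v)}η`, `e_v ≥ 0`; p. 427: *"[a proper power of L^{j(v)}η for vertices (1.8), (1.9), (1.10), (1.11)]"*).
[cite: Balaban1983Higgs3, (2.14) p.427] -/
theorem vertexWeights_le_VF (j : Fin m → ℕ) :
    (∏ v, A.η ^ M.d * A.η ^ M.e v) * (∏ v, ((M.L : ℝ) ^ M.low 0 v j A.k) ^ M.d) ≤ M.VF 0 A.k j := by
  have hreps : M.reps 0 = Finset.univ := by
    ext b
    simp [Model.mem_reps]
  have heAt : ∀ b, M.eAt 0 b = M.e b := by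
    intro b
    unfold Model.eAt
    rw [if_neg (by simp [Model.Nontriv, Model.before_zero])]
  unfold Model.VF
  rw [hreps, ← prod_mul_distrib]
  refine prod_le_prod (fun v _ => ?_) fun v _ => ?_
  · exact mul_nonneg (mul_nonneg (pow_nonneg A.η_pos.le _) (Real.rpow_nonneg A.η_pos.le _))
      (pow_nonneg (pow_nonneg M.L_pos_real.le _) _)
  · rw [heAt]
    have hsc : 0 < M.sc A.k (M.low 0 v j A.k) := M.sc_pos _ _
    have h1 : A.η ^ M.e v ≤ M.sc A.k (M.low 0 v j A.k) ^ M.e v :=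
      Real.rpow_le_rpow A.η_pos.le (A.η_le_sc _) (A.e_nonneg v)
    have h2 : 0 ≤ ((M.L : ℝ) ^ M.low 0 v j A.k) ^ M.d * A.η ^ M.d := by
      have := M.L_pos_real
      have := A.η_pos
      positivity
    rw [Real.rpow_add hsc, Real.rpow_natCast]
    calc A.η ^ M.d * A.η ^ M.e v * ((M.L : ℝ) ^ M.low 0 v j A.k) ^ M.d
        = ((M.L : ℝ) ^ M.low 0 v j A.k) ^ M.d * A.η ^ M.d * A.η ^ M.e v := by ring
      _ ≤ ((M.L : ℝ) ^ M.low 0 v j A.k) ^ M.d * A.η ^ M.d * M.sc A.k (M.low 0 v j A.k) ^ M.e v :=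
          mul_le_mul_of_nonneg_left h1 h2
      _ = M.sc A.k (M.low 0 v j A.k) ^ M.d * M.sc A.k (M.low 0 v j A.k) ^ M.e v := by
          rw [A.sc_eq, mul_pow]

/-! ## (2.13) -/

/-- **(2.13) p. 426 for the localized lattice graph amplitudes, PROVED**: for every scale assignment `j ∈ J(l̃)`,
`|E(G(j), {□(v)}, Φ′_ext, A_ext)| ≤ (Π_l C_l) · e^{d_v(G)} λ^{d_s(G)} exp[−½δ₁ d({□(v)})] (Π_v N^Φ_v)(Π_v N^A_v) ·
Σ_{{Δ(v)}} Ẽ(G(j), {Δ(v)})`, the last factor being the gen-2 weight sum `Model.W 0 k j □` of (2.14).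
[cite: Balaban1983Higgs3, (2.13) p.426] -/
theorem abs_E_le {j : Fin m → ℕ} (hj : j ∈ Model.Mon m A.k) :
    |A.E j| ≤ (∏ l, A.C l)
      * (A.eRun ^ (∑ v, A.dv v) * A.lamRun ^ (∑ v, A.ds v) * Real.exp (-(M.δ₀ * boxTreeLen M.L A.k A.box))
          * (∏ v, A.NPhi v) * ∏ v, A.NA v)
      * M.W 0 A.k j A.box := by
  -- Step 1: absolute values of all factors, the termwise bound, constants out of the sum
  have step1 : |A.E j| ≤ A.Kc j * ((∏ v, A.η ^ M.d * A.η ^ M.e v)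
      * ∑ x ∈ boxPositions M.L A.k A.box, M.EXP 0 j (A.loc j x)) := by
    unfold E
    calc |∑ x ∈ boxPositions M.L A.k A.box,
            (∏ v, A.η ^ M.d * A.u v (x v)) * ∏ l, A.K l (j l) (x (M.src l)) (x (M.tgt l))|
        ≤ ∑ x ∈ boxPositions M.L A.k A.box,
            |(∏ v, A.η ^ M.d * A.u v (x v)) * ∏ l, A.K l (j l) (x (M.src l)) (x (M.tgt l))| :=
          abs_sum_le_sum_abs _ _
      _ ≤ ∑ x ∈ boxPositions M.L A.k A.box, A.Kc j * ((∏ v, A.η ^ M.d * A.η ^ M.e v) * M.EXP 0 j (A.loc j x)) :=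
          sum_le_sum fun x hx => A.abs_term_le hj hx
      _ = A.Kc j * ((∏ v, A.η ^ M.d * A.η ^ M.e v) * ∑ x ∈ boxPositions M.L A.k A.box, M.EXP 0 j (A.loc j x)) := by
          rw [mul_sum, mul_sum]
  -- Step 2: localize to the cubes Δ(v) and compare with the vertex factors of (2.14)
  have step2 : (∏ v, A.η ^ M.d * A.η ^ M.e v) * ∑ x ∈ boxPositions M.L A.k A.box, M.EXP 0 j (A.loc j x)
      ≤ ∑ Θ ∈ M.Locs 0 A.k j A.box, M.VF 0 A.k j * M.EXP 0 j Θ := by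
    rw [A.sum_EXP_loc j, mul_sum]
    refine sum_le_sum fun Θ _ => ?_
    rw [← mul_assoc]
    exact mul_le_mul_of_nonneg_right (A.vertexWeights_le_VF j) (M.EXP_pos 0 j Θ).le
  -- Step 3: assemble into the weight sum (2.14)
  have hW : A.Kc j * ∑ Θ ∈ M.Locs 0 A.k j A.box, M.VF 0 A.k j * M.EXP 0 j Θ
      = (∏ l, A.C l) * (A.eRun ^ (∑ v, A.dv v) * A.lamRun ^ (∑ v, A.ds v)
          * Real.exp (-(M.δ₀ * boxTreeLen M.L A.k A.box)) * (∏ v, A.NPhi v) * ∏ v, A.NA v)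
        * M.W 0 A.k j A.box := by
    rw [A.Kc_eq j, A.prod_cw]
    unfold Model.W
    rw [mul_sum, mul_sum]
    refine sum_congr rfl fun Θ _ => ?_
    ring
  calc |A.E j| ≤ A.Kc j * ((∏ v, A.η ^ M.d * A.η ^ M.e v)
        * ∑ x ∈ boxPositions M.L A.k A.box, M.EXP 0 j (A.loc j x)) := step1
    _ ≤ A.Kc j * ∑ Θ ∈ M.Locs 0 A.k j A.box, M.VF 0 A.k j * M.EXP 0 j Θ :=
        mul_le_mul_of_nonneg_left step2 (A.Kc_nonneg j)
    _ = _ := hW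

end Amp

/-! ## The typed row: `Ineq213` on r15's carrier, and the (1.33)-shaped bound via (2.15) -/

namespace Amp

variable {V : Type} [Fintype V] [DecidableEq V] {m : ℕ} {G : Counts V m} (A : Amp G.toModel)

/-- **Row B3.Eq2.13-2.14, the MODEL INSTANCE of r15's typed claim (2.13)**: for the localized lattice graph amplitudes over
the count data `G` of (2.14) (`B3Ineq215.Counts`: `a_l = Counts.lineDim l`, `e_v = etaPow v`, `δ₀ = ½δ₁`) and every scale
assignment `j ∈ J(l̃)`, `B3Sect2FirstEstimate.Ineq213` holds on the carrier `Counts.toScaledGraph k j □` with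
`O(1) = Π_l C_l`, `Eval = E`, the couplings `e`, `λ` with `d_v(G) = Σ_v d_v(v)`, `d_s(G) = Σ_v d_s(v)`, the tree length
`d({□(v)}) = boxTreeLen`, `‖hΦ_ext‖₁ = Π_v N^Φ_v`, `‖h′A_ext‖₁ = Π_v N^A_v`. [cite: Balaban1983Higgs3, (2.13) p.426] -/
theorem ineq213 {j : Fin m → ℕ} (hj : j ∈ Model.Mon m A.k) :
    Ineq213 (G.toScaledGraph A.k j A.box) (∏ l, A.C l) {j} A.E A.eRun A.lamRun (∑ v, A.dv v) (∑ v, A.ds v)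
      (boxTreeLen G.L A.k A.box) (∏ v, A.NPhi v) (∏ v, A.NA v) := by
  unfold Ineq213
  rw [sum_singleton, sum_singleton, G.Etilde_eq_W A.k (Model.mem_Mon.1 hj).2 A.box]
  dsimp only
  have h := A.abs_E_le hj
  rw [toModel_L, toModel_δ₀] at h
  calc |A.E j| ≤ _ := h
    _ = _ := by ring

/-- The displayed form of (2.13), summed over `j ∈ J(l̃)` on both sides: `|Σ_{j∈J(l̃)} E(G(j), …)| ≤ (Π C_l) e^{d_v}λ^{d_s}
exp[−½δ₁d({□(v)})] (ΠN^Φ)(ΠN^A) Σ_{j∈J(l̃)} Σ_{{Δ(v)}} Ẽ(G(j), {Δ(v)})`. [cite: Balaban1983Higgs3, (2.13) p.426] -/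
theorem ineq213_sum :
    |∑ j ∈ Model.Mon m A.k, A.E j|
      ≤ (∏ l, A.C l) * (A.eRun ^ (∑ v, A.dv v) * A.lamRun ^ (∑ v, A.ds v)
          * Real.exp (-(G.δ₁ / 2 * boxTreeLen G.L A.k A.box)) * (∏ v, A.NPhi v) * ∏ v, A.NA v)
        * ∑ j ∈ Model.Mon m A.k, (G.toScaledGraph A.k j A.box).Etilde j := by
  rw [mul_sum]
  calc |∑ j ∈ Model.Mon m A.k, A.E j| ≤ ∑ j ∈ Model.Mon m A.k, |A.E j| := abs_sum_le_sum_abs _ _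
    _ ≤ _ := sum_le_sum fun j hj => by
        rw [G.Etilde_eq_W A.k (Model.mem_Mon.1 hj).2 A.box]
        have h := A.abs_E_le hj
        rw [toModel_L, toModel_δ₀] at h
        exact h

/-- **The bound of Proposition 2.1 / (1.33) for the model, for a fixed ordering l̃** (p. 425: *"To prove the theorem it is
sufficient to prove the estimate (1.33) for the sum with fixed ordering l̃"*; p. 427: *"To prove the theorem it is sufficient
to prove (2.15)"*): (2.13) (this file) ∧ (2.15) (gen 2, `Model.ineq215_of_pos`) ⇒ `|Σ_{j∈J(l̃)} E(G(j), {□(v)}, Φ′_ext, A_ext)|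
≤ (Π C_l)·const215 · e^{d_v(G)} λ^{d_s(G)} exp[−½δ₁ d({□(v)})] (Π N^Φ_v)(Π N^A_v)`, uniformly in `k` and the unit cubes, under
the hypothesis of p. 426 that every connected component of every `G_i` has positive degree — assembled by gen 2's
`Counts.bound133_of_ineq213`. [cite: Balaban1983Higgs3, Prop. 2.1 p.424] -/
theorem bound133
    (hpos : ∀ i, i ≤ m → ∀ b ∈ G.toModel.reps i, G.toModel.Nontriv i b → 0 < G.toModel.D i b) :
    |∑ j ∈ Model.Mon m A.k, A.E j|
      ≤ (∏ l, A.C l) * G.toModel.const215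
        * (A.eRun ^ (∑ v, A.dv v) * A.lamRun ^ (∑ v, A.ds v) * Real.exp (-(G.δ₁ / 2 * boxTreeLen G.L A.k A.box))
          * (∏ v, A.NPhi v) * ∏ v, A.NA v) :=
  G.bound133_of_ineq213 hpos A.k A.box (prod_nonneg fun l _ => A.C_nonneg l) A.eRun_nonneg A.lamRun_nonneg
    (prod_nonneg fun v _ => A.NPhi_nonneg v) (prod_nonneg fun v _ => A.NA_nonneg v) A.E
    (fun _ hj => A.ineq213 hj)

end Amp

end Literature.MathematicalPhysics.QuantumFieldTheory.Balaban1983to89.B3Ineq213
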